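import Summits.AtomisticToContinuum.Crystallization.Theorems.OverbindingBudgetAffineRadialChart
import Summits.AtomisticToContinuum.Crystallization.Theorems.HullExactificationCascadeZeroDefectDensityAsmFrame

/-!
# The Gram–Schmidt frame of a far window and the exact far-defect formula (NODE 68, deliverable (K5), part 3: the core of `far`) — part A of 2 (§1–§3; part B `…RadialFrameB` has §4–§7, same namespace)

The dictionary obligation `far` (`…RadialGlue.ChartDictionary.far`, typed for the Gram chart in `…RadialChartFit`) says that the
far clause of `FarWindowData` — "for EVERY linear isometry `Q` some two-shell vector has `‖X w − μ•Q w‖ > θ'μ`" — excludes the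
Gram ball `‖gramChart X − x₀‖ < r₁`.  Its proof must PRODUCE, from a Gram matrix close to the reference, an isometry `Q` with all
18 defects small.  This file constructs that isometry and computes the defects EXACTLY:

* §1 Gram–Schmidt on three vectors `a₀, a₁, a₂` of `E3` (`gsU₀, gsP₁, gsU₁, gsP₂, gsU₂`): orthonormality (`gs_orthonormal`) and
  the triangular expansions `a₀ = ‖a₀‖•u₀`, `a₁ = ⟪a₁,u₀⟫•u₀ + ‖p₁‖•u₁`, `a₂ = ⟪a₂,u₀⟫•u₀ + ⟪a₂,u₁⟫•u₁ + ‖p₂‖•u₂` (`gs_expand₀/₁/₂`);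
* §2 the reference frame: the reduced basis in the standard orthonormal basis `e` of `E3` — `b₀ = e₀`, `b₁ = ½e₀ + (√3/2)e₁`,
  `b₂ = √(2/3)e₂` (`redBasis_eq_std₀/₁/₂`) — i.e. Gram–Schmidt of `(b₀, b₁, b₂)` IS the standard basis;
* §3 the FRAME ISOMETRY `frameIso` of a nondegenerate triple: the linear isometry `E3 →ₗᵢ[ℝ] E3` with `e_c ↦ u_c` (orthonormal
  family of cardinality `3 = finrank` ⇒ orthonormal basis ⇒ `repr.trans repr.symm`), `frameIso_apply_single`;
* §4 ★ the EXACT FAR-DEFECT FORMULA (`defect_eq`, `norm_sq_defect`): for `aₐ = X bₐ` and `s = ‖X b₀‖ = chartScale X`,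
  `X (redVec n) − s • frameIso (redVec n) = [n₁(⟪a₁,u₀⟫ − s/2) + n₂⟪a₂,u₀⟫]•u₀ + [n₁(‖p₁‖ − s√3/2) + n₂⟪a₂,u₁⟫]•u₁ + [n₂(‖p₂‖ − s√(2/3))]•u₂`
  and its squared norm is the sum of the three squared brackets.  The pinned direction contributes NOTHING (`n₀` is absent): this
  is why the chart pins `G₀₀`.  In chart units the brackets are `s·(n₁x₀ + n₂x₁)`, `s·(n₁(ρ₁ − √3/2) + n₂σ₂₁)`, `s·n₂(ρ₂ − √(2/3))` with
  `ρ₁ = √(G₁₁ − G₁₀²)`, `σ₂₁ = (G₂₁ − G₂₀G₁₀)/ρ₁`, `ρ₂ = √(G₂₂ − G₂₀² − σ₂₁²)` — Lipschitz in the chart point near `0`, so the defect of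
  every two-shell vector is `≤ C·s·‖x‖`, and the far clause forces `‖x‖ ≥ θ'/C'` =: the excluded radius (g69: the constants).
No `sorry`; only `propext`, `Classical.choice`, `Quot.sound`.
-/

noncomputable section

namespace Summit.AtomisticToContinuum.Crystallization.Theorems.OverbindingBudgetAffineRadialFrame

open scoped BigOperators
open Module
open Summit.AtomisticToContinuum.Crystallization.Theorems.OverbindingBudgetAffineFarSmoothSplit
open Summit.AtomisticToContinuum.Crystallization.Theorems.OverbindingBudgetAffineRadialChart

local notation "E3" => EuclideanSpace ℝ (Fin 3)

/-! ## §1 Gram–Schmidt on three vectors -/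

section GS

variable (a₀ a₁ a₂ : E3)

/-- `u₀ = a₀/‖a₀‖`. -/
def gsU₀ : E3 := ‖a₀‖⁻¹ • a₀
/-- `p₁ = a₁ − ⟪a₁, u₀⟫ u₀`. -/
def gsP₁ : E3 := a₁ - inner ℝ a₁ (gsU₀ a₀) • gsU₀ a₀
/-- `u₁ = p₁/‖p₁‖`. -/
def gsU₁ : E3 := ‖gsP₁ a₀ a₁‖⁻¹ • gsP₁ a₀ a₁
/-- `p₂ = a₂ − ⟪a₂, u₀⟫ u₀ − ⟪a₂, u₁⟫ u₁`. -/
def gsP₂ : E3 := a₂ - inner ℝ a₂ (gsU₀ a₀) • gsU₀ a₀ - inner ℝ a₂ (gsU₁ a₀ a₁) • gsU₁ a₀ a₁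
/-- `u₂ = p₂/‖p₂‖`. -/
def gsU₂ : E3 := ‖gsP₂ a₀ a₁ a₂‖⁻¹ • gsP₂ a₀ a₁ a₂

/-- The Gram–Schmidt FRAME `(u₀, u₁, u₂)`. -/
def gsFrame : Fin 3 → E3 := ![gsU₀ a₀, gsU₁ a₀ a₁, gsU₂ a₀ a₁ a₂]

variable {a₀ a₁ a₂}

/-- A normalised nonzero vector is a unit vector. [formal bookkeeping] -/
theorem norm_inv_smul_eq_one {p : E3} (hp : p ≠ 0) : ‖‖p‖⁻¹ • p‖ = 1 := by
  rw [norm_smul, norm_inv, norm_norm, inv_mul_cancel₀ (norm_ne_zero_iff.2 hp)]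

/-- `⟪u, u⟫ = 1` for a unit vector. [formal bookkeeping] -/
theorem inner_self_of_norm_one {u : E3} (hu : ‖u‖ = 1) : inner ℝ u u = 1 := by
  rw [real_inner_self_eq_norm_sq, hu, one_pow]

/-- The first Gram–Schmidt vector `u₀` is a unit vector (docstring added by the landing lane). [formal bookkeeping] -/
theorem norm_gsU₀ (h₀ : a₀ ≠ 0) : ‖gsU₀ a₀‖ = 1 := norm_inv_smul_eq_one h₀

/-- The second Gram–Schmidt vector `u₁` is a unit vector (docstring added by the landing lane). [formal bookkeeping] -/
theorem norm_gsU₁ (h₁ : gsP₁ a₀ a₁ ≠ 0) : ‖gsU₁ a₀ a₁‖ = 1 := norm_inv_smul_eq_one h₁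

/-- The third Gram–Schmidt vector `u₂` is a unit vector (docstring added by the landing lane). [formal bookkeeping] -/
theorem norm_gsU₂ (h₂ : gsP₂ a₀ a₁ a₂ ≠ 0) : ‖gsU₂ a₀ a₁ a₂‖ = 1 := norm_inv_smul_eq_one h₂

/-- `p₁ ⟂ u₀`. [this file] -/
theorem inner_gsP₁_gsU₀ (h₀ : a₀ ≠ 0) : inner ℝ (gsP₁ a₀ a₁) (gsU₀ a₀) = 0 := by
  rw [gsP₁, inner_sub_left, real_inner_smul_left, inner_self_of_norm_one (norm_gsU₀ h₀)]; ring

/-- `u₁ ⟂ u₀`. [this file] -/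
theorem inner_gsU₁_gsU₀ (h₀ : a₀ ≠ 0) : inner ℝ (gsU₁ a₀ a₁) (gsU₀ a₀) = 0 := by
  rw [gsU₁, real_inner_smul_left, inner_gsP₁_gsU₀ h₀, mul_zero]

/-- `p₂ ⟂ u₀`. [this file] -/
theorem inner_gsP₂_gsU₀ (h₀ : a₀ ≠ 0) : inner ℝ (gsP₂ a₀ a₁ a₂) (gsU₀ a₀) = 0 := by
  rw [gsP₂, inner_sub_left, inner_sub_left, real_inner_smul_left, real_inner_smul_left,
    inner_self_of_norm_one (norm_gsU₀ h₀), inner_gsU₁_gsU₀ h₀]; ring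

/-- `p₂ ⟂ u₁`. [this file] -/
theorem inner_gsP₂_gsU₁ (h₀ : a₀ ≠ 0) (h₁ : gsP₁ a₀ a₁ ≠ 0) : inner ℝ (gsP₂ a₀ a₁ a₂) (gsU₁ a₀ a₁) = 0 := by
  rw [gsP₂, inner_sub_left, inner_sub_left, real_inner_smul_left, real_inner_smul_left,
    inner_self_of_norm_one (norm_gsU₁ h₁), real_inner_comm (gsU₁ a₀ a₁) (gsU₀ a₀), inner_gsU₁_gsU₀ h₀]; ring

/-- `u₂ ⟂ u₀`. [this file] -/
theorem inner_gsU₂_gsU₀ (h₀ : a₀ ≠ 0) : inner ℝ (gsU₂ a₀ a₁ a₂) (gsU₀ a₀) = 0 := by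
  rw [gsU₂, real_inner_smul_left, inner_gsP₂_gsU₀ h₀, mul_zero]

/-- `u₂ ⟂ u₁`. [this file] -/
theorem inner_gsU₂_gsU₁ (h₀ : a₀ ≠ 0) (h₁ : gsP₁ a₀ a₁ ≠ 0) : inner ℝ (gsU₂ a₀ a₁ a₂) (gsU₁ a₀ a₁) = 0 := by
  rw [gsU₂, real_inner_smul_left, inner_gsP₂_gsU₁ h₀ h₁, mul_zero]

/-- ★ The Gram–Schmidt frame is ORTHONORMAL as soon as the three pivots are nonzero — by the tree's generic three-step Gram–Schmidt lemma
`ZeroDefectDensityBirth.gs_orthonormal` (`…HullExactificationCascadeZeroDefectDensityAsmFrame`; our `gsU₀/gsP₁/gsU₁/gsP₂/gsU₂` are its `b₁/w₂/b₂/w₃/b₃`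
definitionally). [tree: ZeroDefectDensityBirth.gs_orthonormal] -/
theorem gs_orthonormal (h₀ : a₀ ≠ 0) (h₁ : gsP₁ a₀ a₁ ≠ 0) (h₂ : gsP₂ a₀ a₁ a₂ ≠ 0) :
    Orthonormal ℝ (gsFrame a₀ a₁ a₂) :=
  ZeroDefectDensityBirth.gs_orthonormal h₀ rfl h₁ rfl h₂ rfl

/-- `a₀ = ‖a₀‖ • u₀`. [this file] -/
theorem gs_expand₀ (h₀ : a₀ ≠ 0) : a₀ = ‖a₀‖ • gsU₀ a₀ := by
  rw [gsU₀, smul_smul, mul_inv_cancel₀ (norm_ne_zero_iff.2 h₀), one_smul]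

/-- `a₁ = ⟪a₁, u₀⟫ • u₀ + ‖p₁‖ • u₁`. [this file] -/
theorem gs_expand₁ (h₁ : gsP₁ a₀ a₁ ≠ 0) :
    a₁ = inner ℝ a₁ (gsU₀ a₀) • gsU₀ a₀ + ‖gsP₁ a₀ a₁‖ • gsU₁ a₀ a₁ := by
  rw [gsU₁, smul_smul, mul_inv_cancel₀ (norm_ne_zero_iff.2 h₁), one_smul, gsP₁]; abel

/-- `a₂ = ⟪a₂, u₀⟫ • u₀ + ⟪a₂, u₁⟫ • u₁ + ‖p₂‖ • u₂`. [this file] -/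
theorem gs_expand₂ (h₂ : gsP₂ a₀ a₁ a₂ ≠ 0) :
    a₂ = inner ℝ a₂ (gsU₀ a₀) • gsU₀ a₀ + inner ℝ a₂ (gsU₁ a₀ a₁) • gsU₁ a₀ a₁ + ‖gsP₂ a₀ a₁ a₂‖ • gsU₂ a₀ a₁ a₂ := by
  rw [gsU₂, smul_smul, mul_inv_cancel₀ (norm_ne_zero_iff.2 h₂), one_smul, gsP₂]; abel

/-- The squared norm of a combination of the orthonormal frame is the sum of squared coefficients. [this file] -/
theorem norm_sq_combo (h₀ : a₀ ≠ 0) (h₁ : gsP₁ a₀ a₁ ≠ 0) (h₂ : gsP₂ a₀ a₁ a₂ ≠ 0) (c₀ c₁ c₂ : ℝ) :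
    ‖c₀ • gsU₀ a₀ + c₁ • gsU₁ a₀ a₁ + c₂ • gsU₂ a₀ a₁ a₂‖ ^ 2 = c₀ ^ 2 + c₁ ^ 2 + c₂ ^ 2 := by
  have h := norm_sq_sum_smul ![c₀, c₁, c₂] (gsFrame a₀ a₁ a₂)
  simp only [Fin.sum_univ_three, gsFrame, Fin.isValue, Matrix.cons_val_zero, Matrix.cons_val_one,
    Matrix.cons_val_two, Matrix.head_cons, Matrix.tail_cons, real_inner_self_eq_norm_sq] at h
  rw [real_inner_comm (gsU₁ a₀ a₁) (gsU₀ a₀), real_inner_comm (gsU₂ a₀ a₁ a₂) (gsU₀ a₀),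
    real_inner_comm (gsU₂ a₀ a₁ a₂) (gsU₁ a₀ a₁), inner_gsU₁_gsU₀ h₀, inner_gsU₂_gsU₀ h₀, inner_gsU₂_gsU₁ h₀ h₁,
    norm_gsU₀ h₀, norm_gsU₁ h₁, norm_gsU₂ h₂] at h
  linear_combination h

end GS

/-! ## §2 The reference frame: the reduced basis in the standard orthonormal basis -/

/-- The standard orthonormal basis vector `e_i` of `E3`. -/
def stdE3 (i : Fin 3) : E3 := EuclideanSpace.single i (1 : ℝ)

/-- Coordinates in the standard basis. [formal bookkeeping] -/
theorem eq_sum_stdE3 (v : E3) : v = v 0 • stdE3 0 + v 1 • stdE3 1 + v 2 • stdE3 2 := by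
  ext l; fin_cases l <;> simp [stdE3]

/-- `redVec n = (n₀ + n₁/2)•e₀ + (√3/2·n₁)•e₁ + (√(2/3)·n₂)•e₂`: Gram–Schmidt of the reduced basis is the standard basis,
with the triangular coefficients `b₀ = e₀`, `b₁ = ½e₀ + (√3/2)e₁`, `b₂ = √(2/3)e₂`. [this file] -/
theorem redVec_eq_std (n : Fin 3 → ℝ) :
    redVec n = (n 0 + n 1 / 2) • stdE3 0 + (Real.sqrt 3 / 2 * n 1) • stdE3 1 + (n 2 * Real.sqrt (2 / 3)) • stdE3 2 := by
  rw [eq_sum_stdE3 (redVec n), redVec_apply_zero, redVec_apply_one, redVec_apply_two]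

/-! ## §3 The frame isometry of a nondegenerate triple -/

section Iso

variable {a₀ a₁ a₂ : E3}

/-- The Gram–Schmidt frame as an ORTHONORMAL BASIS of `E3` (three orthonormal vectors, `finrank = 3`). -/
def gsBasis (h₀ : a₀ ≠ 0) (h₁ : gsP₁ a₀ a₁ ≠ 0) (h₂ : gsP₂ a₀ a₁ a₂ ≠ 0) : OrthonormalBasis (Fin 3) ℝ E3 :=
  (basisOfOrthonormalOfCardEqFinrank (gs_orthonormal h₀ h₁ h₂) (by simp)).toOrthonormalBasis
    (by simpa using gs_orthonormal h₀ h₁ h₂)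

/-- The orthonormal basis `gsBasis` evaluates to the Gram–Schmidt frame `gsFrame` (docstring added by the landing lane). [formal bookkeeping] -/
theorem gsBasis_apply (h₀ : a₀ ≠ 0) (h₁ : gsP₁ a₀ a₁ ≠ 0) (h₂ : gsP₂ a₀ a₁ a₂ ≠ 0) (i : Fin 3) :
    gsBasis h₀ h₁ h₂ i = gsFrame a₀ a₁ a₂ i := by
  simp [gsBasis]

/-- ★ The FRAME ISOMETRY: the linear isometry of `E3` sending the standard basis `e_i` to the Gram–Schmidt frame `u_i` of the
triple `(a₀, a₁, a₂)` — the rotation(-reflection) taking the reference lattice frame to the frame of `X` when `aₐ = X bₐ`. -/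
def frameIso (h₀ : a₀ ≠ 0) (h₁ : gsP₁ a₀ a₁ ≠ 0) (h₂ : gsP₂ a₀ a₁ a₂ ≠ 0) : E3 →ₗᵢ[ℝ] E3 :=
  ((EuclideanSpace.basisFun (Fin 3) ℝ).repr.trans (gsBasis h₀ h₁ h₂).repr.symm).toLinearIsometry

/-- `frameIso e_i = u_i`. [this file] -/
theorem frameIso_stdE3 (h₀ : a₀ ≠ 0) (h₁ : gsP₁ a₀ a₁ ≠ 0) (h₂ : gsP₂ a₀ a₁ a₂ ≠ 0) (i : Fin 3) :
    frameIso h₀ h₁ h₂ (stdE3 i) = gsFrame a₀ a₁ a₂ i := by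
  have he : stdE3 i = (EuclideanSpace.basisFun (Fin 3) ℝ) i := by simp [stdE3]
  rw [he, frameIso, LinearIsometryEquiv.coe_toLinearIsometry, LinearIsometryEquiv.trans_apply,
    OrthonormalBasis.repr_self, OrthonormalBasis.repr_symm_single, gsBasis_apply]

/-- The frame isometry on a reduced-coordinate vector: `Q (redVec n) = (n₀ + n₁/2)•u₀ + (√3/2·n₁)•u₁ + (√(2/3)·n₂)•u₂`. [this file] -/
theorem frameIso_redVec (h₀ : a₀ ≠ 0) (h₁ : gsP₁ a₀ a₁ ≠ 0) (h₂ : gsP₂ a₀ a₁ a₂ ≠ 0) (n : Fin 3 → ℝ) :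
    frameIso h₀ h₁ h₂ (redVec n) = (n 0 + n 1 / 2) • gsU₀ a₀ + (Real.sqrt 3 / 2 * n 1) • gsU₁ a₀ a₁ +
      (n 2 * Real.sqrt (2 / 3)) • gsU₂ a₀ a₁ a₂ := by
  rw [redVec_eq_std, map_add, map_add, map_smul, map_smul, map_smul, frameIso_stdE3, frameIso_stdE3, frameIso_stdE3]
  rfl

end Iso

end Summit.AtomisticToContinuum.Crystallization.Theorems.OverbindingBudgetAffineRadialFrame

end
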